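import Summits.QuantumFields.YangMills.Theorems.BalabanUVNodesN15AtSpineCarriersBackground
import Summits.QuantumFields.YangMills.Theorems.BalabanUVNodesN15VectorPieceVWords

/-!
# YM-DAG node N15 (= NE2) AT THE RATE CARRIERS OF RECORD, RE-KEYED WITH THE (3.60)-SHAPED FULL PERTURBATION `V′(A′) = V′₁(A′) − [F₂*aQ + Q*aF₂ + F₂*aF₂](A′)`
# LIVE: the K4 stub `YMDAG.UVSplit.S_N15 RRec` closed over every rate-carrier predicate whose NE2 component carries the realised FULL-PERTURBATION family of the
# U = 1 vector piece ⊗ 1_𝔤 (gauge field `A′` the datum; block mean `Q` concrete; averaging-perturbation species `F₂`, `F₂*` with their six letters DISPLAYED) —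
# the OPERATOR layer a theorem by name modulo the species letters, the site-kernel and unit-lattice layers displayed

Track A of `YM-PLAN.md` (cell `pub-ymgap`, HUMAN RULING D-0062), node **N15**; typed by seat `pub-ymgap-dag-n15-c` (generation g4) as the spine-carrier faces of its
(V5) chain (`…N15BackgroundAveragingWords`, `…N15BackgroundVWordsByName`, `…N15BackgroundVWordsNode`, `…N15VectorPieceVWords`).  Shape twin and import: this seat's
(g0) `BalabanUVNodesN15AtSpineCarriersBackground` and (g3) `BalabanUVNodesN15AtSpineCarriersV1Gauge` (same namespace, nothing restated).  Producer consumed BY NAME: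
this seat's `VectorPiece.ne2PlusOperator_vectorPiece_vWordsG`.  Kernel bookkeeping: 0 `def`, 0 `sorry`, standard axioms.  COUNT-NEUTRAL; `--supports` the K3′ item
`SpineGivenEndpointR12` (stmt-QuantumFields-19908, helper).

THE STUB.  `S_N15 RRec := ∀ F D g₀ os R, RRec F D g₀ os R → N15At R.ne2`, `N15At c := NE2PlusOperator c.c35 c.pi c.Kop ∧ NE2PlusSite 4 c.p c.c35 c.pi c.Ksite ∧
NE2PlusUnit c.c35 c.pi c.Kunit c.inΛ c.unitDist`.

WHAT THIS MODULE IS.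
* §1 THE NODE FACE WITH THE FULL PERTURBATION LIVE: **`n15At_vectorPiece_vWordsG_of_layers`** — for `d + 1 ≥ 2`, `L ≥ 1`, `c₃₅ > 0`, coordinates `e : 𝔄 ≃L[ℝ] ℝ^ι`,
  a (3.24) weight `a`, an averaging-perturbation species (`Fc`, `Fsc`, `Ff`, `Fsf`) with the six letters of `VectorPiece.vecWord_letters` (`c_F ≥ 0`; the
  letters are spelled out as hypotheses in every face), on the NE2
  carriers indexed by `VecIndexS d L` whose paired instances ∕ operator kernels are `v1GVecInstance` ∕ `vWGVecFamily4`, `N15At` follows from the site-kernel and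
  unit-lattice layers — the operator conjunct is the producer's theorem.
* §2 (W2) CLOSER, refinement-generic: **`s_N15_of_vWordsReading`**.
* §3 GUARD: `not_n15At_iff_site_or_unit_fails_vWordsG` — on these carriers `N15At` FAILS iff the site OR the unit layer fails.

HONEST FRAMING.  NE2 is NOT PRINTED beyond King's scalar template and NOT PROVED for Bałaban's `G(U)`.  What enters by name is the operator layer of the LINEAR
(U = 1) vector single-scale piece of [B5]∕[B6]∕King (4.42) tensored with `1_𝔤`, dressed by the print's `V′₁(A)` of (3.52) MINUS the three averaging words of (3.60)
with the block mean CONCRETE and the averaging-perturbation species `F₂(A′)`, `F₂*(A′)` ABSTRACT — their six letters (sup = (3.59)-shape; two-spacing fit NOT PRINTED)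
are HYPOTHESES of every face below; the print's `F′₂ⱼ(A)` of (3.55)–(3.58) is NOT constructed; (3.35) = OUR unit-scale reading of the printed C² pair; transport =
fibrewise mean (linearised (C3)); NOT the multiscale carrier of NODE 00; the SITE-KERNEL and UNIT-LATTICE layers of `N15At` remain DISPLAYED.  N15 is NOT discharged
(0∕1 at every record); typed 28∕28, discharged count untouched; one finite four-torus programme at fixed `ε` — NOT ℝ⁴, NOT infinite volume, NOT OS, NOT a mass gap,
NOT Clay.  Restate-immune.  No decl below carries a cite tag.
-/

noncomputable section

open Finset

namespace Summit.QuantumFields.YangMills.Theorems.N15AtSpineCarriers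

open Literature.MathematicalPhysics.QuantumFieldTheory.Balaban1983to89
open Literature.MathematicalPhysics.QuantumFieldTheory.Balaban1983to89.T4Continuum
open Literature.MathematicalPhysics.QuantumFieldTheory.Balaban1983to89.B9 (SiteKernel)
open Literature.MathematicalPhysics.QuantumFieldTheory.Balaban1983to89.B11SectG (BlockNorm HasMaj)
open Literature.MathematicalPhysics.QuantumFieldTheory.Balaban1983to89.T4EtaRate (PairedInstance NE2PlusOperator NE2PlusSite NE2PlusUnit)
open Literature.MathematicalPhysics.QuantumFieldTheory.Balaban1983to89.T4EtaRateDefect (idef)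
open Literature.MathematicalPhysics.QuantumFieldTheory.Balaban1983to89.T4EtaRateCoeffDefect (pull diagK)
open Literature.MathematicalPhysics.QuantumFieldTheory.Balaban1983to89.B5Prop11Plancherel (Tor fine)
open Summit.QuantumFields.YangMills.BalabanUVNodes.N15.MatrixSpecies (liftMap liftBlk)
open Summit.QuantumFields.YangMills.BalabanUVNodes.N15.VectorPiece (VecIndexS v1GVecInstance vWGVecFamily4 ne2PlusOperator_vectorPiece_vWordsG unitTorusGeoS
  blkFine kingPrV thetaV)
open YMDAG.UVSplit (Datum NE2Carriers RateCarriers RateRecordPred N15At RatesAt S_N15)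

variable {N : ℕ} [NeZero N] {d : ℕ} {L : ℕ} [NeZero L] {ι : Type} [Fintype ι] [DecidableEq ι]
  {𝔄 : Type} [NormedRing 𝔄] [NormedAlgebra ℝ 𝔄] [CompleteSpace 𝔄] (e : 𝔄 ≃L[ℝ] (ι → ℝ)) (a : ℝ)

/-! ## §1 The node face with the full perturbation live: `N15At` from the site and unit layers and the species letters -/

section Faces

variable {hL : 1 ≤ L} {c35 cF : ℝ}
  {Fc : ∀ j : VecIndexS d L, (Fin (d + 1) → Tor (fine (L ^ j.m * L ^ j.k) j.Mn) × Fin (d + 1) → 𝔄) →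
    (((Tor (fine (L ^ j.k) j.Mn) × Fin (d + 1)) × ι → ℝ) →ₗ[ℝ] ((Tor j.Mn × Fin (d + 1)) × ι → ℝ))}
  {Fsc : ∀ j : VecIndexS d L, (Fin (d + 1) → Tor (fine (L ^ j.m * L ^ j.k) j.Mn) × Fin (d + 1) → 𝔄) →
    (((Tor j.Mn × Fin (d + 1)) × ι → ℝ) →ₗ[ℝ] ((Tor (fine (L ^ j.k) j.Mn) × Fin (d + 1)) × ι → ℝ))}
  {Ff : ∀ j : VecIndexS d L, (Fin (d + 1) → Tor (fine (L ^ j.m * L ^ j.k) j.Mn) × Fin (d + 1) → 𝔄) →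
    (((Tor (fine (L ^ j.m * L ^ j.k) j.Mn) × Fin (d + 1)) × ι → ℝ) →ₗ[ℝ] ((Tor j.Mn × Fin (d + 1)) × ι → ℝ))}
  {Fsf : ∀ j : VecIndexS d L, (Fin (d + 1) → Tor (fine (L ^ j.m * L ^ j.k) j.Mn) × Fin (d + 1) → 𝔄) →
    (((Tor j.Mn × Fin (d + 1)) × ι → ℝ) →ₗ[ℝ] ((Tor (fine (L ^ j.m * L ^ j.k) j.Mn) × Fin (d + 1)) × ι → ℝ))}

/-- **`N15At` WITH THE (3.60)-SHAPED FULL PERTURBATION LIVE, FROM THE SITE AND UNIT LAYERS AND THE SPECIES LETTERS.**  On the NE2 carriers indexed by the sized family,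
with paired instances `v1GVecInstance` (gauge fields `A′`, (3.35) = unit-scale C² letters, guard = the index's `M`) and operator kernels `vWGVecFamily4` (the
constructed pair with `V′₁(A′) − [F₂*aQ + Q*aF₂ + F₂*aF₂](A′)` fed with the -a pieces ⊗ 1_𝔤, forward AND backward derived pieces), the operator conjunct is
`VectorPiece.ne2PlusOperator_vectorPiece_vWordsG` (for `d + 1 ≥ 2`, `L ≥ 1`, `c₃₅ > 0`, `c_F ≥ 0` and the six species letters); `N15At` follows from the two
displayed layers. [bookkeeping] -/
theorem n15At_vectorPiece_vWordsG_of_layers (hd : 1 ≤ d) (hc35 : 0 < c35) (hcF : 0 ≤ cF)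
    (hF : ∀ (j : VecIndexS d L) (α₀ : ℝ) A', 0 < α₀ → 2 * (c35 * (j.Msz * α₀)) ≤ 1 → (v1GVecInstance (d := d) 𝔄 ι L hL j).Bf.Reg335 c35 α₀ A' →
      HasMaj (BlockNorm.ofBlocks (unitTorusGeoS L j.k j.Mn j.Msz) (liftBlk (blkFine L j.k j.Mn) ι))
        (BlockNorm.ofBlocks (unitTorusGeoS L j.k j.Mn j.Msz) (liftBlk (fun b : Tor j.Mn × Fin (d + 1) => b.1) ι)) (Fc j A')
        (diagK fun _ => cF * (c35 * j.Msz * α₀)) ∧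
      HasMaj (BlockNorm.ofBlocks (unitTorusGeoS L j.k j.Mn j.Msz) (liftBlk (fun b : Tor j.Mn × Fin (d + 1) => b.1) ι))
        (BlockNorm.ofBlocks (unitTorusGeoS L j.k j.Mn j.Msz) (liftBlk (blkFine L j.k j.Mn) ι)) (Fsc j A') (diagK fun _ => cF * (c35 * j.Msz * α₀)) ∧
      HasMaj (BlockNorm.ofBlocks (unitTorusGeoS L j.k j.Mn j.Msz) (liftBlk (blkFine L j.k j.Mn ∘ kingPrV L j.k j.m j.Mn) ι))
        (BlockNorm.ofBlocks (unitTorusGeoS L j.k j.Mn j.Msz) (liftBlk (fun b : Tor j.Mn × Fin (d + 1) => b.1) ι)) (Ff j A')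
        (diagK fun _ => cF * (c35 * j.Msz * α₀)) ∧
      HasMaj (BlockNorm.ofBlocks (unitTorusGeoS L j.k j.Mn j.Msz) (liftBlk (fun b : Tor j.Mn × Fin (d + 1) => b.1) ι))
        (BlockNorm.ofBlocks (unitTorusGeoS L j.k j.Mn j.Msz) (liftBlk (blkFine L j.k j.Mn ∘ kingPrV L j.k j.m j.Mn) ι)) (Fsf j A')
        (diagK fun _ => cF * (c35 * j.Msz * α₀)) ∧
      HasMaj (BlockNorm.ofBlocks (unitTorusGeoS L j.k j.Mn j.Msz) (liftBlk (blkFine L j.k j.Mn) ι))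
        (BlockNorm.ofBlocks (unitTorusGeoS L j.k j.Mn j.Msz) (liftBlk (fun b : Tor j.Mn × Fin (d + 1) => b.1) ι))
        (idef (pull (liftMap (kingPrV L j.k j.m j.Mn) ι)) LinearMap.id (Ff j A') (Fc j A')) (diagK fun _ => cF * (c35 * j.Msz * α₀) * thetaV L j) ∧
      HasMaj (BlockNorm.ofBlocks (unitTorusGeoS L j.k j.Mn j.Msz) (liftBlk (fun b : Tor j.Mn × Fin (d + 1) => b.1) ι))
        (BlockNorm.ofBlocks (unitTorusGeoS L j.k j.Mn j.Msz) (liftBlk (blkFine L j.k j.Mn ∘ kingPrV L j.k j.m j.Mn) ι))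
        (idef LinearMap.id (pull (liftMap (kingPrV L j.k j.m j.Mn) ι)) (Fsf j A') (Fsc j A')) (diagK fun _ => cF * (c35 * j.Msz * α₀) * thetaV L j)) (p : ℝ)
    (Ksite Kunit : ∀ j : VecIndexS d L, SiteKernel (v1GVecInstance (d := d) 𝔄 ι L hL j).gc (v1GVecInstance (d := d) 𝔄 ι L hL j).Bf)
    (inΛ : ∀ j : VecIndexS d L, (v1GVecInstance (d := d) 𝔄 ι L hL j).gc.Site → Prop)
    (unitDist : ∀ j : VecIndexS d L, (v1GVecInstance (d := d) 𝔄 ι L hL j).gc.Site → (v1GVecInstance (d := d) 𝔄 ι L hL j).gc.Site → ℝ)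
    (hsite : NE2PlusSite 4 p c35 (v1GVecInstance (d := d) 𝔄 ι L hL) Ksite)
    (hunit : NE2PlusUnit c35 (v1GVecInstance (d := d) 𝔄 ι L hL) Kunit inΛ unitDist) :
    N15At { I := VecIndexS d L, c35 := c35, p := p, pi := v1GVecInstance (d := d) 𝔄 ι L hL, Kop := vWGVecFamily4 (d := d) 𝔄 ι e L a hL Fc Fsc Ff Fsf,
            Ksite := Ksite, Kunit := Kunit, inΛ := inΛ, unitDist := unitDist } :=
  ⟨ne2PlusOperator_vectorPiece_vWordsG (d := d) e a hd hL c35 hc35 hcF Fc Fsc Ff Fsf hF, hsite, hunit⟩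

end Faces

/-! ## §2 (W2) closer: `S_N15` for every rate-record predicate whose NE2 component IS the full-perturbation family plus the two remaining layers -/

section Closers

/-- **`S_N15` FOR EVERY FULL-PERTURBATION READING** (the carriers of `n15At_vectorPiece_vWordsG_of_layers`): if `RRec` hands, with every bundle `R` it pins, an
identification of `R.ne2` with those carriers (any `c₃₅ > 0`, weight `a`, species with the six letters at some `c_F ≥ 0`, exponent `p`, site ∕ unit kernels,
region, unit distance) together with the site-kernel and unit-lattice layers on them, then `S_N15 RRec` — the operator layer is a theorem by name modulo the
displayed species letters. [bookkeeping] -/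
theorem s_N15_of_vWordsReading (hd : 1 ≤ d) (hL : 1 ≤ L) (RRec : RateRecordPred N)
    (hread : ∀ (F : T4Family) (D : Datum F N) (g₀ : ℕ → ℝ) (os : List (ULoop F)) (R : RateCarriers N), RRec F D g₀ os R →
      ∃ (c35 cF a p : ℝ)
        (Fc : ∀ j : VecIndexS d L, (Fin (d + 1) → Tor (fine (L ^ j.m * L ^ j.k) j.Mn) × Fin (d + 1) → 𝔄) →
          (((Tor (fine (L ^ j.k) j.Mn) × Fin (d + 1)) × ι → ℝ) →ₗ[ℝ] ((Tor j.Mn × Fin (d + 1)) × ι → ℝ)))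
        (Fsc : ∀ j : VecIndexS d L, (Fin (d + 1) → Tor (fine (L ^ j.m * L ^ j.k) j.Mn) × Fin (d + 1) → 𝔄) →
          (((Tor j.Mn × Fin (d + 1)) × ι → ℝ) →ₗ[ℝ] ((Tor (fine (L ^ j.k) j.Mn) × Fin (d + 1)) × ι → ℝ)))
        (Ff : ∀ j : VecIndexS d L, (Fin (d + 1) → Tor (fine (L ^ j.m * L ^ j.k) j.Mn) × Fin (d + 1) → 𝔄) →
          (((Tor (fine (L ^ j.m * L ^ j.k) j.Mn) × Fin (d + 1)) × ι → ℝ) →ₗ[ℝ] ((Tor j.Mn × Fin (d + 1)) × ι → ℝ)))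
        (Fsf : ∀ j : VecIndexS d L, (Fin (d + 1) → Tor (fine (L ^ j.m * L ^ j.k) j.Mn) × Fin (d + 1) → 𝔄) →
          (((Tor j.Mn × Fin (d + 1)) × ι → ℝ) →ₗ[ℝ] ((Tor (fine (L ^ j.m * L ^ j.k) j.Mn) × Fin (d + 1)) × ι → ℝ)))
        (Ksite Kunit : ∀ j : VecIndexS d L, SiteKernel (v1GVecInstance (d := d) 𝔄 ι L hL j).gc (v1GVecInstance (d := d) 𝔄 ι L hL j).Bf)
        (inΛ : ∀ j : VecIndexS d L, (v1GVecInstance (d := d) 𝔄 ι L hL j).gc.Site → Prop)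
        (unitDist : ∀ j : VecIndexS d L, (v1GVecInstance (d := d) 𝔄 ι L hL j).gc.Site → (v1GVecInstance (d := d) 𝔄 ι L hL j).gc.Site → ℝ),
        0 < c35 ∧ 0 ≤ cF ∧
        (∀ (j : VecIndexS d L) (α₀ : ℝ) A', 0 < α₀ → 2 * (c35 * (j.Msz * α₀)) ≤ 1 → (v1GVecInstance (d := d) 𝔄 ι L hL j).Bf.Reg335 c35 α₀ A' →
      HasMaj (BlockNorm.ofBlocks (unitTorusGeoS L j.k j.Mn j.Msz) (liftBlk (blkFine L j.k j.Mn) ι))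
        (BlockNorm.ofBlocks (unitTorusGeoS L j.k j.Mn j.Msz) (liftBlk (fun b : Tor j.Mn × Fin (d + 1) => b.1) ι)) (Fc j A')
        (diagK fun _ => cF * (c35 * j.Msz * α₀)) ∧
      HasMaj (BlockNorm.ofBlocks (unitTorusGeoS L j.k j.Mn j.Msz) (liftBlk (fun b : Tor j.Mn × Fin (d + 1) => b.1) ι))
        (BlockNorm.ofBlocks (unitTorusGeoS L j.k j.Mn j.Msz) (liftBlk (blkFine L j.k j.Mn) ι)) (Fsc j A') (diagK fun _ => cF * (c35 * j.Msz * α₀)) ∧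
      HasMaj (BlockNorm.ofBlocks (unitTorusGeoS L j.k j.Mn j.Msz) (liftBlk (blkFine L j.k j.Mn ∘ kingPrV L j.k j.m j.Mn) ι))
        (BlockNorm.ofBlocks (unitTorusGeoS L j.k j.Mn j.Msz) (liftBlk (fun b : Tor j.Mn × Fin (d + 1) => b.1) ι)) (Ff j A')
        (diagK fun _ => cF * (c35 * j.Msz * α₀)) ∧
      HasMaj (BlockNorm.ofBlocks (unitTorusGeoS L j.k j.Mn j.Msz) (liftBlk (fun b : Tor j.Mn × Fin (d + 1) => b.1) ι))
        (BlockNorm.ofBlocks (unitTorusGeoS L j.k j.Mn j.Msz) (liftBlk (blkFine L j.k j.Mn ∘ kingPrV L j.k j.m j.Mn) ι)) (Fsf j A')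
        (diagK fun _ => cF * (c35 * j.Msz * α₀)) ∧
      HasMaj (BlockNorm.ofBlocks (unitTorusGeoS L j.k j.Mn j.Msz) (liftBlk (blkFine L j.k j.Mn) ι))
        (BlockNorm.ofBlocks (unitTorusGeoS L j.k j.Mn j.Msz) (liftBlk (fun b : Tor j.Mn × Fin (d + 1) => b.1) ι))
        (idef (pull (liftMap (kingPrV L j.k j.m j.Mn) ι)) LinearMap.id (Ff j A') (Fc j A')) (diagK fun _ => cF * (c35 * j.Msz * α₀) * thetaV L j) ∧
      HasMaj (BlockNorm.ofBlocks (unitTorusGeoS L j.k j.Mn j.Msz) (liftBlk (fun b : Tor j.Mn × Fin (d + 1) => b.1) ι))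
        (BlockNorm.ofBlocks (unitTorusGeoS L j.k j.Mn j.Msz) (liftBlk (blkFine L j.k j.Mn ∘ kingPrV L j.k j.m j.Mn) ι))
        (idef LinearMap.id (pull (liftMap (kingPrV L j.k j.m j.Mn) ι)) (Fsf j A') (Fsc j A')) (diagK fun _ => cF * (c35 * j.Msz * α₀) * thetaV L j)) ∧
        R.ne2 = { I := VecIndexS d L, c35 := c35, p := p, pi := v1GVecInstance (d := d) 𝔄 ι L hL, Kop := vWGVecFamily4 (d := d) 𝔄 ι e L a hL Fc Fsc Ff Fsf,
                  Ksite := Ksite, Kunit := Kunit, inΛ := inΛ, unitDist := unitDist } ∧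
        NE2PlusSite 4 p c35 (v1GVecInstance (d := d) 𝔄 ι L hL) Ksite ∧ NE2PlusUnit c35 (v1GVecInstance (d := d) 𝔄 ι L hL) Kunit inΛ unitDist) :
    S_N15 RRec := by
  intro F D g₀ os R hR
  obtain ⟨c35, cF, a, p, Fc, Fsc, Ff, Fsf, Ksite, Kunit, inΛ, unitDist, hc35, hcF, hF, hne2, hsite, hunit⟩ := hread F D g₀ os R hR
  rw [hne2]
  exact n15At_vectorPiece_vWordsG_of_layers e a hd hc35 hcF hF p Ksite Kunit inΛ unitDist hsite hunit

end Closers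

/-! ## §3 Guard: on the full-perturbation carriers the operator layer is never the reason `N15At` fails -/

section Guard

variable {hL : 1 ≤ L} {c35 cF : ℝ}
  {Fc : ∀ j : VecIndexS d L, (Fin (d + 1) → Tor (fine (L ^ j.m * L ^ j.k) j.Mn) × Fin (d + 1) → 𝔄) →
    (((Tor (fine (L ^ j.k) j.Mn) × Fin (d + 1)) × ι → ℝ) →ₗ[ℝ] ((Tor j.Mn × Fin (d + 1)) × ι → ℝ))}
  {Fsc : ∀ j : VecIndexS d L, (Fin (d + 1) → Tor (fine (L ^ j.m * L ^ j.k) j.Mn) × Fin (d + 1) → 𝔄) →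
    (((Tor j.Mn × Fin (d + 1)) × ι → ℝ) →ₗ[ℝ] ((Tor (fine (L ^ j.k) j.Mn) × Fin (d + 1)) × ι → ℝ))}
  {Ff : ∀ j : VecIndexS d L, (Fin (d + 1) → Tor (fine (L ^ j.m * L ^ j.k) j.Mn) × Fin (d + 1) → 𝔄) →
    (((Tor (fine (L ^ j.m * L ^ j.k) j.Mn) × Fin (d + 1)) × ι → ℝ) →ₗ[ℝ] ((Tor j.Mn × Fin (d + 1)) × ι → ℝ))}
  {Fsf : ∀ j : VecIndexS d L, (Fin (d + 1) → Tor (fine (L ^ j.m * L ^ j.k) j.Mn) × Fin (d + 1) → 𝔄) →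
    (((Tor j.Mn × Fin (d + 1)) × ι → ℝ) →ₗ[ℝ] ((Tor (fine (L ^ j.m * L ^ j.k) j.Mn) × Fin (d + 1)) × ι → ℝ))}

/-- **ON THE FULL-PERTURBATION CARRIERS `N15At` FAILS IFF THE SITE OR THE UNIT LAYER FAILS** (given the species letters, the operator layer holds by
`VectorPiece.ne2PlusOperator_vectorPiece_vWordsG`): the honest residue of N15 on this family is the pair of displayed layers. [bookkeeping] -/
theorem not_n15At_iff_site_or_unit_fails_vWordsG (hd : 1 ≤ d) (hc35 : 0 < c35) (hcF : 0 ≤ cF)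
    (hF : ∀ (j : VecIndexS d L) (α₀ : ℝ) A', 0 < α₀ → 2 * (c35 * (j.Msz * α₀)) ≤ 1 → (v1GVecInstance (d := d) 𝔄 ι L hL j).Bf.Reg335 c35 α₀ A' →
      HasMaj (BlockNorm.ofBlocks (unitTorusGeoS L j.k j.Mn j.Msz) (liftBlk (blkFine L j.k j.Mn) ι))
        (BlockNorm.ofBlocks (unitTorusGeoS L j.k j.Mn j.Msz) (liftBlk (fun b : Tor j.Mn × Fin (d + 1) => b.1) ι)) (Fc j A')
        (diagK fun _ => cF * (c35 * j.Msz * α₀)) ∧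
      HasMaj (BlockNorm.ofBlocks (unitTorusGeoS L j.k j.Mn j.Msz) (liftBlk (fun b : Tor j.Mn × Fin (d + 1) => b.1) ι))
        (BlockNorm.ofBlocks (unitTorusGeoS L j.k j.Mn j.Msz) (liftBlk (blkFine L j.k j.Mn) ι)) (Fsc j A') (diagK fun _ => cF * (c35 * j.Msz * α₀)) ∧
      HasMaj (BlockNorm.ofBlocks (unitTorusGeoS L j.k j.Mn j.Msz) (liftBlk (blkFine L j.k j.Mn ∘ kingPrV L j.k j.m j.Mn) ι))
        (BlockNorm.ofBlocks (unitTorusGeoS L j.k j.Mn j.Msz) (liftBlk (fun b : Tor j.Mn × Fin (d + 1) => b.1) ι)) (Ff j A')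
        (diagK fun _ => cF * (c35 * j.Msz * α₀)) ∧
      HasMaj (BlockNorm.ofBlocks (unitTorusGeoS L j.k j.Mn j.Msz) (liftBlk (fun b : Tor j.Mn × Fin (d + 1) => b.1) ι))
        (BlockNorm.ofBlocks (unitTorusGeoS L j.k j.Mn j.Msz) (liftBlk (blkFine L j.k j.Mn ∘ kingPrV L j.k j.m j.Mn) ι)) (Fsf j A')
        (diagK fun _ => cF * (c35 * j.Msz * α₀)) ∧
      HasMaj (BlockNorm.ofBlocks (unitTorusGeoS L j.k j.Mn j.Msz) (liftBlk (blkFine L j.k j.Mn) ι))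
        (BlockNorm.ofBlocks (unitTorusGeoS L j.k j.Mn j.Msz) (liftBlk (fun b : Tor j.Mn × Fin (d + 1) => b.1) ι))
        (idef (pull (liftMap (kingPrV L j.k j.m j.Mn) ι)) LinearMap.id (Ff j A') (Fc j A')) (diagK fun _ => cF * (c35 * j.Msz * α₀) * thetaV L j) ∧
      HasMaj (BlockNorm.ofBlocks (unitTorusGeoS L j.k j.Mn j.Msz) (liftBlk (fun b : Tor j.Mn × Fin (d + 1) => b.1) ι))
        (BlockNorm.ofBlocks (unitTorusGeoS L j.k j.Mn j.Msz) (liftBlk (blkFine L j.k j.Mn ∘ kingPrV L j.k j.m j.Mn) ι))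
        (idef LinearMap.id (pull (liftMap (kingPrV L j.k j.m j.Mn) ι)) (Fsf j A') (Fsc j A')) (diagK fun _ => cF * (c35 * j.Msz * α₀) * thetaV L j)) (p : ℝ)
    (Ksite Kunit : ∀ j : VecIndexS d L, SiteKernel (v1GVecInstance (d := d) 𝔄 ι L hL j).gc (v1GVecInstance (d := d) 𝔄 ι L hL j).Bf)
    (inΛ : ∀ j : VecIndexS d L, (v1GVecInstance (d := d) 𝔄 ι L hL j).gc.Site → Prop)
    (unitDist : ∀ j : VecIndexS d L, (v1GVecInstance (d := d) 𝔄 ι L hL j).gc.Site → (v1GVecInstance (d := d) 𝔄 ι L hL j).gc.Site → ℝ) :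
    ¬ N15At { I := VecIndexS d L, c35 := c35, p := p, pi := v1GVecInstance (d := d) 𝔄 ι L hL, Kop := vWGVecFamily4 (d := d) 𝔄 ι e L a hL Fc Fsc Ff Fsf,
              Ksite := Ksite, Kunit := Kunit, inΛ := inΛ, unitDist := unitDist } ↔
      ¬ NE2PlusSite 4 p c35 (v1GVecInstance (d := d) 𝔄 ι L hL) Ksite ∨ ¬ NE2PlusUnit c35 (v1GVecInstance (d := d) 𝔄 ι L hL) Kunit inΛ unitDist := by
  constructor
  · intro h
    by_cases hs : NE2PlusSite 4 p c35 (v1GVecInstance (d := d) 𝔄 ι L hL) Ksite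
    · by_cases hu : NE2PlusUnit c35 (v1GVecInstance (d := d) 𝔄 ι L hL) Kunit inΛ unitDist
      · exact absurd (n15At_vectorPiece_vWordsG_of_layers e a hd hc35 hcF hF p Ksite Kunit inΛ unitDist hs hu) h
      · exact Or.inr hu
    · exact Or.inl hs
  · rintro (hs | hu) ⟨_, hsite, hunit⟩
    · exact hs hsite
    · exact hu hunit

end Guard

end Summit.QuantumFields.YangMills.Theorems.N15AtSpineCarriers

end
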